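import Literature.Probability.Percolation.PlateCrossingEvents
import Literature.Probability.Percolation.QuadCrossingSquareModel
import Literature.Probability.RandomPlanarGeometry.ConformalRectangleProofs
import HarnessLib

/-!
# Plate paths in square-model coordinates are bond plate paths of `(Q, r)`

Topic `Literature/Probability/Percolation`; proofs only.  For a square model `Φ` of a conformal
rectangle `Q` (`IsSquareModel Q Φ`: `Φ((-1,1)²) = Q`, arcs `0`/`2` = images of the bottom/top
sides) and a room `r > 0`, there is `κ ∈ (0, 1/2]` such that at every mesh the primal vertical
plate crossing of the plate `(1+κ, 1-κ, 1+κ)` (an open path of `ℤ²_δ` drawn inside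
`Φ([-(1+κ), 1+κ]²)` from `Φ{im ≤ -(1-κ)}` to `Φ{1-κ ≤ im}`) is an open path inside the
`r`-neighbourhood of `Q` from the `r`-neighbourhood of `Q.arc 0` to that of `Q.arc 2`
(`plateContainment_holds`): uniform continuity of `Φ` on `[-2,2]²` (`exists_chart_room_forward`)
and clamping into `[-1,1]²`.  Geometric step S0 of the transfer of crossing probabilities between
lattices via plate events (Camia–Newman, CMP 268 (2006), §5–6).

## References

* F. Camia, C. M. Newman, Comm. Math. Phys. 268 (2006), §5–6 [CamiaNewman2006].
-/

noncomputable section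

namespace Literature.Probability.Percolation

open Literature.Probability.RandomPlanarGeometry
open Literature.Probability.LatticeModels
open Filter _root_.Topology Set Metric Complex

/-- **Chart room, forward**: on the box `plateBox 2 2` the chart is uniformly continuous — for every
`ν > 0` there is `ρ > 0` such that points of the box at distance `≤ ρ` have images at distance
`≤ ν`. [folklore] -/
theorem exists_chart_room_forward (Φ : ℂ ≃ₜ ℂ) {ν : ℝ} (hν : 0 < ν) :
    ∃ ρ : ℝ, 0 < ρ ∧ ∀ z ∈ plateBox 2 2, ∀ w ∈ plateBox 2 2, dist z w ≤ ρ → dist (Φ z) (Φ w) ≤ ν := by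
  have huc : UniformContinuousOn Φ (plateBox 2 2) :=
    ((isCompact_Icc.reProdIm isCompact_Icc : IsCompact (plateBox 2 2))).uniformContinuousOn_of_continuous Φ.continuous.continuousOn
  obtain ⟨ρ, hρ, h⟩ := Metric.uniformContinuousOn_iff_le.1 huc ν hν
  exact ⟨ρ, hρ, h⟩

/-- Clamping into `[-1, 1]` lands in `[-1, 1]`. [folklore] -/
theorem clamp1_mem (t : ℝ) : (max (-1) (min 1 t)) ∈ Icc (-1 : ℝ) 1 :=
  ⟨le_max_left _ _, max_le (by norm_num) (min_le_left _ _)⟩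

/-- Clamping a point of `[-(1+κ), 1+κ]` into `[-1, 1]` moves it by at most `κ`. [folklore] -/
theorem abs_sub_clamp1_le {t κ : ℝ} (hκ : 0 ≤ κ) (ht : t ∈ Icc (-(1 + κ)) (1 + κ)) : |t - (max (-1) (min 1 t))| ≤ κ := by
  rcases le_total t 1 with h1 | h1
  · rw [min_eq_right h1]
    rcases le_total (-1) t with h2 | h2
    · rw [max_eq_right h2, sub_self, abs_zero]; exact hκ
    · rw [max_eq_left h2, abs_of_nonpos (by linarith)]; linarith [ht.1]
  · rw [min_eq_left h1, max_eq_right (by norm_num : (-1 : ℝ) ≤ 1), abs_of_nonneg (by linarith)]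
    linarith [ht.2]

/-- The distance of two complex numbers is at most the sum of the coordinate distances. [folklore] -/
theorem dist_le_abs_re_add_abs_im (z w : ℂ) : dist z w ≤ |z.re - w.re| + |z.im - w.im| := by
  rw [dist_eq_norm]
  refine (norm_le_abs_re_add_abs_im (z - w)).trans ?_
  rw [sub_re, sub_im]

/-- A point of `plateBox (1+κ) (1+κ)` is within `2κ` of the clamped point of `plateBox 1 1`. [folklore] -/
theorem dist_clamp_le {κ : ℝ} (hκ : 0 ≤ κ) {z : ℂ} (hz : z ∈ plateBox (1 + κ) (1 + κ)) :
    dist z ⟨(max (-1) (min 1 z.re)), (max (-1) (min 1 z.im))⟩ ≤ 2 * κ := by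
  refine (dist_le_abs_re_add_abs_im _ _).trans ?_
  have h1 := abs_sub_clamp1_le hκ hz.1
  have h2 := abs_sub_clamp1_le hκ hz.2
  change |z.re - (max (-1) (min 1 z.re))| + |z.im - (max (-1) (min 1 z.im))| ≤ 2 * κ
  linarith

/-- **S0 holds**: the primal vertical plate event of `P₂ = (1+κ, 1-κ, 1+κ)` is contained in the
bond plate-path event of `(Q, r)`, for `κ` small in terms of the chart room of `r`. [folklore] -/
theorem plateContainment_holds :
  ∀ (Q : ConformalRectangle) (Φ : ℂ ≃ₜ ℂ), IsSquareModel Q Φ → ∀ r : ℝ, 0 < r →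
    ∃ κ : ℝ, 0 < κ ∧ κ ≤ 1 / 2 ∧ ∀ δ : ℝ, 0 < δ →
      zdPlateV (meshPoint δ) Φ (1 + κ) (1 - κ) (1 + κ) ⊆
        openCrossing {x : Site 2 | meshPoint δ x ∈ cthickening r Q.carrier}
          {x | meshPoint δ x ∈ cthickening r (Q.arc 0)} {x | meshPoint δ x ∈ cthickening r (Q.arc 2)} := by
  intro Q Φ hΦ r hr
  obtain ⟨ρ, hρ, hroom⟩ := exists_chart_room_forward Φ hr
  -- κ with 2κ ≤ ρ and κ ≤ 1/2
  set κ : ℝ := min (ρ / 2) (1 / 2) with hκdef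
  have hκ : 0 < κ := lt_min (by positivity) (by norm_num)
  have hκρ : 2 * κ ≤ ρ := by
    have : κ ≤ ρ / 2 := min_le_left _ _
    linarith
  have hκ1 : κ ≤ 1 / 2 := min_le_right _ _
  refine ⟨κ, hκ, hκ1, fun δ _ => ?_⟩
  -- the two box inclusions used below
  have hbig : plateBox (1 + κ) (1 + κ) ⊆ plateBox 2 2 := by
    intro z hz
    exact ⟨⟨by linarith [hz.1.1], by linarith [hz.1.2]⟩, ⟨by linarith [hz.2.1], by linarith [hz.2.2]⟩⟩
  have hsmall : plateBox 1 1 ⊆ plateBox 2 2 := by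
    intro z hz
    exact ⟨⟨by linarith [hz.1.1], by linarith [hz.1.2]⟩, ⟨by linarith [hz.2.1], by linarith [hz.2.2]⟩⟩
  -- plate points are `r`-close to the closed quad
  have hplate : ∀ w : Site 2, meshPoint δ w ∈ Φ '' plateBox (1 + κ) (1 + κ) →
      meshPoint δ w ∈ cthickening r Q.carrier := by
    rintro w ⟨z, hz, hzw⟩
    set z' : ℂ := ⟨(max (-1) (min 1 z.re)), (max (-1) (min 1 z.im))⟩ with hz'
    have hz'mem : z' ∈ plateBox 1 1 := ⟨clamp1_mem _, clamp1_mem _⟩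
    have hd : dist (Φ z) (Φ z') ≤ r :=
      hroom z (hbig hz) z' (hsmall hz'mem) ((dist_clamp_le hκ.le hz).trans hκρ)
    have hΦz' : Φ z' ∈ closure Q.carrier := by
      rw [← hΦ.image_Icc]; exact mem_image_of_mem Φ hz'mem
    rw [← cthickening_closure, ← hzw]
    exact mem_cthickening_of_dist_le (Φ z) (Φ z') r _ hΦz' hd
  -- zone points are `r`-close to the corresponding arc
  have hzone0 : ∀ w : Site 2, meshPoint δ w ∈ Φ '' plateBox (1 + κ) (1 + κ) →
      meshPoint δ w ∈ Φ '' {z : ℂ | z.im ≤ -(1 - κ)} → meshPoint δ w ∈ cthickening r (Q.arc 0) := by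
    rintro w ⟨z, hz, hzw⟩ ⟨z₂, hz₂, hz₂w⟩
    have hzz : z₂ = z := Φ.injective (hz₂w.trans hzw.symm)
    subst hzz
    set z' : ℂ := ⟨(max (-1) (min 1 z₂.re)), -1⟩ with hz'
    have hz'arc : z' ∈ unitSquareQuad.arc 0 := SquareModel.mem_arc_zero.2 ⟨rfl, clamp1_mem _⟩
    have hz'box : z' ∈ plateBox 2 2 := ⟨⟨by linarith [(clamp1_mem z₂.re).1], by linarith [(clamp1_mem z₂.re).2]⟩,
      ⟨by norm_num, by norm_num⟩⟩
    have hdz : dist z₂ z' ≤ 2 * κ := by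
      refine (dist_le_abs_re_add_abs_im _ _).trans ?_
      have h1 := abs_sub_clamp1_le hκ.le hz.1
      have him1 : z₂.im ≤ -(1 - κ) := hz₂
      have him2 : -(1 + κ) ≤ z₂.im := hz.2.1
      have h2 : |z₂.im - (-1)| ≤ κ := by rw [abs_le]; constructor <;> linarith
      change |z₂.re - (max (-1) (min 1 z₂.re))| + |z₂.im - (-1)| ≤ 2 * κ
      linarith
    have hd : dist (Φ z₂) (Φ z') ≤ r := hroom z₂ (hbig hz) z' hz'box (hdz.trans hκρ)
    have hΦz' : Φ z' ∈ Q.arc 0 := by rw [← hΦ.image_arc 0]; exact mem_image_of_mem Φ hz'arc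
    rw [← hz₂w]
    exact mem_cthickening_of_dist_le (Φ z₂) (Φ z') r _ hΦz' hd
  have hzone2 : ∀ w : Site 2, meshPoint δ w ∈ Φ '' plateBox (1 + κ) (1 + κ) →
      meshPoint δ w ∈ Φ '' {z : ℂ | 1 - κ ≤ z.im} → meshPoint δ w ∈ cthickening r (Q.arc 2) := by
    rintro w ⟨z, hz, hzw⟩ ⟨z₂, hz₂, hz₂w⟩
    have hzz : z₂ = z := Φ.injective (hz₂w.trans hzw.symm)
    subst hzz
    set z' : ℂ := ⟨(max (-1) (min 1 z₂.re)), 1⟩ with hz'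
    have hz'arc : z' ∈ unitSquareQuad.arc 2 := SquareModel.mem_arc_two.2 ⟨rfl, clamp1_mem _⟩
    have hz'box : z' ∈ plateBox 2 2 := ⟨⟨by linarith [(clamp1_mem z₂.re).1], by linarith [(clamp1_mem z₂.re).2]⟩,
      ⟨by norm_num, by norm_num⟩⟩
    have hdz : dist z₂ z' ≤ 2 * κ := by
      refine (dist_le_abs_re_add_abs_im _ _).trans ?_
      have h1 := abs_sub_clamp1_le hκ.le hz.1
      have him1 : 1 - κ ≤ z₂.im := hz₂
      have him2 : z₂.im ≤ 1 + κ := hz.2.2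
      have h2 : |z₂.im - 1| ≤ κ := by rw [abs_le]; constructor <;> linarith
      change |z₂.re - (max (-1) (min 1 z₂.re))| + |z₂.im - 1| ≤ 2 * κ
      linarith
    have hd : dist (Φ z₂) (Φ z') ≤ r := hroom z₂ (hbig hz) z' hz'box (hdz.trans hκρ)
    have hΦz' : Φ z' ∈ Q.arc 2 := by rw [← hΦ.image_arc 2]; exact mem_image_of_mem Φ hz'arc
    rw [← hz₂w]
    exact mem_cthickening_of_dist_le (Φ z₂) (Φ z') r _ hΦz' hd
  -- the inclusion of events
  rintro ω ⟨u, hu, v, hv, hconn⟩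
  have huS : meshPoint δ u ∈ Φ '' plateBox (1 + κ) (1 + κ) := hconn.1
  have hvS : meshPoint δ v ∈ Φ '' plateBox (1 + κ) (1 + κ) := hconn.2.1
  exact ⟨u, hzone0 u huS hu, v, hzone2 v hvS hv, openConnIn_mono (fun w hw => hplate w hw) u v hconn⟩

end Literature.Probability.Percolation

end
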